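import Mathlib
import Summits.MatrixMultiplication.MatrixMultiplication.Theses.HiddenToeplitzCorners
import Summits.MatrixMultiplication.MatrixMultiplication.Cruxes.HiddenCorners.LawOfEnds
import Summits.MatrixMultiplication.MatrixMultiplication.Cruxes.HiddenCorners.ApolarKernelPlacement

/-!
# Width one is honest — typed disproof-side targets (crux-strategist gen 2, STRATEGY-CENSUS §6.4)

Crux `HiddenCorners` (stmt-MatrixMultiplication-7492).  Companion of `STRATEGY-CENSUS.md` (gen 2) §6.4 and of
`LawOfEnds.lean` (gen 1).  No `HiddenCorners_of` here (the census records why no constructive line is registered).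

* `WidthOneLaw` — the law of ends at split width `d = 1`: every split-SP pencil of width one has `r ≤ 2`
  (`= SplitNeutralLaw` restricted to `d = 1` with the sharp constant).
* `widthOne_reduction` — the REDUCTION LEMMA (paper proof in the census §6.4; `sorry` here): a generically
  nonsingular width-one pencil `T(X) = L(g)U(η(X)) + L(γ(X))U(h)` with `g = z^s·unit`, `h = z^t·unit` is, after
  invertible constant triangular Toeplitz multipliers, block-triangular with diagonal blocks `L_s(γ′(X))`,
  `U_t(η′(X))` and an HONEST Toeplitz pencil of size `N − s − t`; hence it is SP iff that honest pencil is SP.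
  Typed here in its consequence form: a width-one split-SP pencil on `M_r` yields an honest Hankel SP pencil on `M_r`
  (of some size), so that
* `widthOneLaw_iff_honest` — `WidthOneLaw ↔ HonestHankelRankLeTwo`: the `d = 1` face of the ω-neutral law IS the
  honest conjecture of `ApolarKernelPlacement.lean`, no more and no less (`→` is the landed Toeplitz packaging of a
  Hankel pencil, `stub_instance` p113538; `←` is the reduction lemma).
-/

set_option linter.dupNamespace false

namespace Summit.MatrixMultiplication.MatrixMultiplication.Cruxes.HiddenCorners.WidthOne

open Summit.MatrixMultiplication.MatrixMultiplication.Theses.HiddenToeplitzCorners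
open Summit.MatrixMultiplication.MatrixMultiplication.Cruxes.HiddenCorners.LawOfEnds (SplitSP SplitNeutralLaw)
open Summit.MatrixMultiplication.MatrixMultiplication.Cruxes.HiddenCorners.ApolarKernelPlacement
  (hankelPencil HonestHankelRankLeTwo)
open scoped BigOperators Matrix

/-- The law of ends at split width one, sharp constant: every split-SP pencil of width `1` has `r ≤ 2`
(the PoC `(r, N, d) = (2, 4, 1)` shows `2` is attained). -/
def WidthOneLaw : Prop :=
  ∀ (r N : ℕ) (T : Fin r → Fin r → Matrix (Fin N) (Fin N) ℂ), SplitSP r N 1 T → r ≤ 2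

/-- `WidthOneLaw` is `SplitNeutralLaw 1 1` up to the constant: the polynomial law with `c = 1, k = 1` at `d = 1`
reads `r ≤ 1 · (1 + 1) = 2`.  (Sanity link to `LawOfEnds.lean`; both directions are immediate.) -/
theorem splitNeutralLaw_one_one_imp : SplitNeutralLaw 1 1 → WidthOneLaw := by
  intro h r N T hT
  simpa using h r N 1 T hT

/-- **Reduction lemma, consequence form** (census §6.4; extends SievesR1K2 F1 to degenerate ends).
A width-one split-SP pencil on `M_r` (any size `N`) yields an honest Hankel SP pencil on `M_r` of some size `N'`
(`N' = N − s − t` where `s = val g`, `t = val h`; the Toeplitz block is flipped to Hankel by `J`).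
Proof (paper): normalise `g̃ = h̃ = 1` by `L(g̃)⁻¹ · T · U(h̃)⁻¹`; in `ℂ[z]/(z^N)` the operator
`p ↦ z^s [η(1/z) p]_{≥0} + γ(z) [z^{-t} p]_{≥0}` is block-triangular for the splitting `p = p_{<t} + z^t p_{≥t}`,
rows `< s` / `[s, s+t)` / `≥ s+t`; the corner blocks are `L_s(γ)` and `U_t(η)` with determinants `γ₀(X)^s`,
`η₀(X)^t` (linear forms — so generic nonsingularity forces `γ₀, η₀ ≢ 0`), and the remaining block is Toeplitz with
symbol `ψ_k = γ_{k+t} + η_{s−k}`; `det_r` irreducible of degree `r ≥ 2` divides the product iff it divides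
`det T_{N'}(ψ_X)`. -/
theorem widthOne_reduction (r N : ℕ) (hr : 2 ≤ r) (T : Fin r → Fin r → Matrix (Fin N) (Fin N) ℂ)
    (hT : SplitSP r N 1 T) :
    ∃ (N' : ℕ) (W : ℕ → Matrix (Fin r) (Fin r) ℂ),
      (∃ X₀ : Matrix (Fin r) (Fin r) ℂ, (hankelPencil r N' W X₀).det ≠ 0) ∧
      ∀ X : Matrix (Fin r) (Fin r) ℂ, X.det = 0 → (hankelPencil r N' W X).det = 0 := by
  sorry

/-- **Packaging, consequence form** (the landed `stub_instance` p113538 / `ApolarKernelPlacement.transfer` route,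
restated without the size/sparsity bookkeeping): an honest Hankel SP pencil is a width-one split-SP pencil of the
same size (`T = H · J`, generators `G₀ = H₀ = e₀`). -/
theorem honest_to_widthOne (r N : ℕ) (W : ℕ → Matrix (Fin r) (Fin r) ℂ)
    (hX₀ : ∃ X₀ : Matrix (Fin r) (Fin r) ℂ, (hankelPencil r N W X₀).det ≠ 0)
    (hS : ∀ X : Matrix (Fin r) (Fin r) ℂ, X.det = 0 → (hankelPencil r N W X).det = 0) :
    ∃ T : Fin r → Fin r → Matrix (Fin N) (Fin N) ℂ, SplitSP r N 1 T := by
  sorry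

/-- **The d = 1 face of the law of ends is exactly the honest conjecture.** -/
theorem widthOneLaw_iff_honest : WidthOneLaw ↔ HonestHankelRankLeTwo := by
  constructor
  · intro hW r N W hX₀ hS
    obtain ⟨T, hT⟩ := honest_to_widthOne r N W hX₀ hS
    exact hW r N T hT
  · intro hH r N T hT
    by_cases hr : 2 ≤ r
    · obtain ⟨N', W, hX₀, hS⟩ := widthOne_reduction r N hr T hT
      exact hH r N' W hX₀ hS
    · omega

end Summit.MatrixMultiplication.MatrixMultiplication.Cruxes.HiddenCorners.WidthOne
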